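import Literature.AlgebraicGeometry.Frobenioids.ArchimedeanTheoremsInstances
import Literature.AlgebraicGeometry.Frobenioids.ArchimedeanPseudoTerminal
import Literature.AlgebraicGeometry.Frobenioids.ArchimedeanIsotropy
import Literature.AlgebraicGeometry.Frobenioids.ArchimedeanDivisors
import HarnessLib

/-!
# Frobenioids II, Proposition 3.5 (ii) WITHOUT the standing hypothesis «`D` totally epimorphic»:
# a COUNTEREXAMPLE (the universal closure of the typed instance `ArchFrd.Prop35ii_C` is false)

Mochizuki, *The geometry of Frobenioids II: poly-Frobenioids*, Kyushu J. Math. **62** (2008) 401–460, §3,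
Prop. 3.5 (ii), kurims p. 34 [cite: MochizukiFrdII2008, Prop 3.5 (ii) p.34]: "The Frobenioid `F` is
quasi-isotropic, i.e., an object of `F` is non-isotropic if and only if it is an iso-subanchor of `F`" — for
`F = C = C₀ ×_{D₀} D` of Ex. 3.3 (i), p. 28: "if `D` is any connected, **totally epimorphic** category, and
`D → D₀` is a functor …", `D` of RC-iso-subanchor type (Def. 3.1 (v), p. 25).

The typed instance `ArchFrd.Prop35ii_C π` (`ArchimedeanTheoremsInstances.lean`; FACT-LIST row F-0862, schema
`ArchFrd.Prop35ii`) quantifies over an ARBITRARY category `D`; the standing hypothesis "totally epimorphic" of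
Ex. 3.3 (i) / [FrdI] §0 is not part of it. It is PROVED under that hypothesis (`ArchFrd.prop35ii_C (hTE)`,
`ArchimedeanQuasiIsotropic.lean`) and outright at the base of [IUTchI] Ex. 3.4 (`prop35ii_C_ptBase`). THIS FILE:
the hypothesis cannot be dropped. Base `D := RB` = the full subcategory of sets on a point `pt` and a
two-point set `two` (all maps; connected; NOT totally epimorphic), `π :=` the constant functor at `Spec ℂ`:
`RB` IS of RC-iso-subanchor type, yet the tip-`1` ISOTROPIC object `U pt` over `pt` is an ISO-SUBANCHOR of `C`
(`isIsoSubanchor_unit`) — `not_prop35ii_C_retract`, `exists_base_not_prop35ii_C`.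

MECHANISM ([FrdI] Rmk. 3.1.1 "an anchor is never isotropic" is where total epimorphicity enters). `pt` is a
retract of `two` by a NON-invertible split monomorphism `r` (retraction `s`, `r ≫ s = id`, `s ≫ r ≠ id`), so
every arrow `φ : X → Y` of `C` out of an object over `pt` factors as `(id, r) ≫ (φ₀, s ≫ φ_D)` with NEITHER
factor invertible: no arrow out of `X` is irreducible and `X` is (vacuously) an ANCHOR, isotropic or not; and
`(id, s) : U two → U pt` is a mono-minimal categorical quotient of the subanchor `U two` by `{γ : γ₀ = id}`
(monomorphisms out of `U two` through which it factors have injective `RB`-component and split-mono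
`C₀`-component, hence are isomorphisms — `C₀` IS totally epimorphic, `C0.isTotallyEpimorphic`). In a totally
epimorphic `D` split monomorphisms are isomorphisms, which rules this out (`ArchFrd.isIso_or_isIso_of_fac_frobHom`).

FACT-LIST: the universal closure `∀ D π, Prop35ii_C π` of row F-0862 is REFUTED here; the printed item WITH its
standing hypothesis is PROVED (`ArchFrd.prop35ii_C`). No claim of the paper is contradicted (it assumes `D`
totally epimorphic throughout); the finding concerns the typed row only. Nothing here bears on [IUTchIII]. -/


namespace Literature.AlgebraicGeometry.Frobenioids

open CategoryTheory

noncomputable section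
namespace ArchFrd


/-- The objects of the retract base: a one-point set `pt` and a two-point set `two`.
[cite: MochizukiFrdII2008, Ex 3.3 (i) p.28] -/
inductive RB : Type
  | pt
  | two

namespace RB

/-- The underlying sets: `pt ↦ Unit`, `two ↦ Bool`. [cite: MochizukiFrdII2008, Ex 3.3 (i) p.28] -/
def carrier : RB → Type
  | pt => Unit
  | two => Bool

/-- `RB` is the full subcategory of sets on `{Unit, Bool}`: morphisms are all maps, composition is
composition of maps. [cite: MochizukiFrdII2008, Ex 3.3 (i) p.28] -/
instance instCategory : Category RB where
  Hom X Y := X.carrier → Y.carrier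
  id _ := fun x => x
  comp f g := fun x => g (f x)
  id_comp _ := rfl
  comp_id _ := rfl
  assoc _ _ _ := rfl

/-- The split monomorphism `r : pt → two` (the point `false`). [cite: MochizukiFrdII2008, Ex 3.3 (i) p.28] -/
def r : pt ⟶ two := fun _ => false

/-- Its retraction `s : two → pt`. [cite: MochizukiFrdII2008, Ex 3.3 (i) p.28] -/
def s : two ⟶ pt := fun _ => ()

/-- The swap `τ` of `two`. [cite: MochizukiFrdII2008, Ex 3.3 (i) p.28] -/
def τ : two ⟶ two := fun b : Bool => !b

/-- `r ≫ s = id` (`r` is a split monomorphism). [cite: MochizukiFrdI2008, §0 p.16] -/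
@[simp] theorem r_comp_s : r ≫ s = 𝟙 pt := rfl

/-- `τ ≫ τ = id`. [cite: MochizukiFrdI2008, §0 p.16] -/
@[simp] theorem τ_comp_τ : τ ≫ τ = 𝟙 two := funext fun b => by cases b <;> rfl

/-- Evaluation of a composite of maps. [cite: MochizukiFrdI2008, §0 p.16] -/
theorem comp_app {X Y Z : RB} (f : X ⟶ Y) (g : Y ⟶ Z) (x : X.carrier) : (f ≫ g) x = g (f x) := rfl

/-- Evaluation of `τ`. [cite: MochizukiFrdI2008, §0 p.16] -/
@[simp] theorem τ_apply (b : Bool) : τ b = !b := rfl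

/-- Any two maps into `pt` agree. [cite: MochizukiFrdI2008, §0 p.16] -/
theorem hom_pt_ext {X : RB} (f g : X ⟶ pt) : f = g := funext fun _ => rfl

/-- A map out of `two` taking the same value twice is not an isomorphism. [cite: MochizukiFrdI2008, §0 p.16] -/
theorem not_isIso_of_apply_eq {d : RB} (g : two ⟶ d) (h : g true = g false) : ¬ IsIso g := by
  intro hg
  have ht : (g ≫ inv g) true = true := by rw [IsIso.hom_inv_id]; rfl
  have hf : (g ≫ inv g) false = false := by rw [IsIso.hom_inv_id]; rfl
  have he : (g ≫ inv g) true = (g ≫ inv g) false := by rw [comp_app, comp_app, h]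
  exact Bool.false_ne_true (hf.symm.trans (he.symm.trans ht))

/-- A map from the point to `two` is not an isomorphism (`r` is not). [cite: MochizukiFrdI2008, §0 p.16] -/
theorem not_isIso_from_pt (g : pt ⟶ two) : ¬ IsIso g := by
  intro hg
  have ht : (inv g ≫ g) true = true := by rw [IsIso.inv_hom_id]; rfl
  have hf : (inv g ≫ g) false = false := by rw [IsIso.inv_hom_id]; rfl
  have hu : (inv g ≫ g) true = (inv g ≫ g) false := rfl
  exact Bool.false_ne_true (hf.symm.trans (hu.symm.trans ht))

/-- `s ≫ g` is never an isomorphism. [cite: MochizukiFrdI2008, §0 p.16] -/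
theorem not_isIso_s_comp {d : RB} (g : pt ⟶ d) : ¬ IsIso (s ≫ g) := not_isIso_of_apply_eq (s ≫ g) rfl

/-- A map out of `two` with two distinct values is an automorphism of `two` (the identity or the swap). [cite: MochizukiFrdI2008, §0 p.16] -/
theorem isIso_of_apply_ne {d : RB} (g : two ⟶ d) (h : g true ≠ g false) : IsIso g := by
  cases d with
  | pt => exact absurd rfl h
  | two =>
    -- `g` is the identity or the swap; in both cases `g ≫ g = id`
    have key : ∀ b : Bool, g (g b) = b := by
      intro b
      have h' : g true ≠ g false := h
      cases b <;> cases ht : g true <;> cases hf : g false <;> simp_all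
    exact ⟨⟨g, funext key, funext key⟩⟩

/-- `τ ≫ ζ = ζ` for a map `ζ` out of `two` taking the same value twice. [cite: MochizukiFrdI2008, §0 p.16] -/
theorem τ_comp_eq_of_apply_eq {d : RB} (ζ : two ⟶ d) (h : ζ true = ζ false) : τ ≫ ζ = ζ := by
  funext b
  rw [comp_app, τ_apply]
  cases b
  · exact h
  · exact h.symm

/-- A monomorphism out of `two` takes distinct values (test against `id` and `τ`), hence is an
isomorphism. [cite: MochizukiFrdI2008, §0 p.16] -/
theorem isIso_of_mono {d : RB} (ζ : two ⟶ d) [Mono ζ] : IsIso ζ := by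
  refine isIso_of_apply_ne ζ fun h => ?_
  have hτ : τ = 𝟙 two := (cancel_mono ζ).1 ((τ_comp_eq_of_apply_eq ζ h).trans (Category.id_comp ζ).symm)
  exact Bool.false_ne_true (congrFun hτ true)

/-- A map out of `two` invariant under the swap is constant. [cite: MochizukiFrdI2008, §0 p.18] -/
theorem apply_eq_of_τ_comp {d : RB} (ψ : two ⟶ d) (h : τ ≫ ψ = ψ) : ψ true = ψ false :=
  congrFun h false

/-- `RB` is connected (`r : pt → two`). [cite: MochizukiFrdI2008, §0 p.16] -/
theorem isGraphConnected : IsGraphConnected RB := by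
  have h : ∀ d : RB, Zigzag pt d := fun d => by cases d; exacts [Zigzag.refl _, Zigzag.of_hom r]
  exact ⟨⟨pt⟩, fun X Y => (h X).symm.trans (h Y)⟩

/-- `RB` is NOT totally epimorphic: `r` is not an epimorphism (`r ≫ id = r ≫ (s ≫ r)`, `id ≠ s ≫ r`).
[cite: MochizukiFrdI2008, §0 p.16] -/
theorem not_isTotallyEpimorphic : ¬ IsTotallyEpimorphic RB := by
  intro h
  haveI : Epi r := h.epi r
  have h1 : 𝟙 two = s ≫ r := (cancel_epi r).1 (by funext u; rfl)
  exact Bool.false_ne_true (congrFun h1 true).symm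

/-- The swap as an automorphism of `two`. [cite: MochizukiFrdI2008, §0 p.16] -/
def τIso : two ≅ two := ⟨τ, τ, τ_comp_τ, τ_comp_τ⟩

end RB


open RB

/-- The functor `D = RB → D₀`, constant at `Spec ℂ` ("`D → D₀` is a functor", Ex. 3.3 (i) p. 28).
[cite: MochizukiFrdII2008, Ex 3.3 (i) p.28] -/
abbrev πR : RB ⥤ D0 := (Functor.const RB).obj D0.complex

/-- `U d`: the object of `C = C₀ ×_{D₀} RB` over `d` with isotropic angular region of tip `1` (this is
`unitObjOver πR d` — by `rfl` —, spelled out so that all `U d` have syntactically the same `C₀`-component).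
[cite: MochizukiFrdII2008, Ex 3.3 (i) p.28] -/
abbrev U (d : RB) : C πR := ⟨C0.unitObj D0.complex, d, Iso.refl D0.complex⟩

/-- The arrow `(id, g) : U d → U d'` of `C` over an arrow `g` of `RB`. [cite: MochizukiFrdII2008, Ex 3.3 (i) p.28] -/
def uHom {d d' : RB} (g : d ⟶ d') : U d ⟶ U d' :=
  ⟨𝟙 _, g, by simp; rfl⟩

/-- Components of `uHom`. [cite: MochizukiFrdII2008, Ex 3.3 (i) p.28] -/
@[simp] theorem uHom_fst {d d' : RB} (g : d ⟶ d') : (uHom g).fst = 𝟙 _ := rfl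

/-- Components of `uHom`. [cite: MochizukiFrdII2008, Ex 3.3 (i) p.28] -/
@[simp] theorem uHom_snd {d d' : RB} (g : d ⟶ d') : (uHom g).snd = g := rfl

/-- The second factor of the canonical factorization of an arrow out of `U pt`: `(φ₀, g₂)` over `two`.
[cite: MochizukiFrdII2008, Ex 3.3 (i) p.28] -/
def lift₂ {Y : C πR} (φ : U pt ⟶ Y) (g₂ : two ⟶ Y.snd) : U two ⟶ Y :=
  ⟨φ.fst, g₂, φ.w⟩

/-- **Every arrow out of an object over `pt` factors through the move over `two`**:
`φ = (id, r) ≫ (φ₀, s ≫ φ_D)`. [cite: MochizukiFrdII2008, Ex 3.3 (i) p.28] -/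
theorem fac_of_over_pt {Y : C πR} (φ : U pt ⟶ Y) : uHom r ≫ lift₂ φ (s ≫ φ.snd) = φ := by
  refine CFP.hom_ext (Category.id_comp _) ?_
  change r ≫ s ≫ φ.snd = φ.snd
  rfl

/-- **No arrow out of `U pt` is irreducible**: both factors of the canonical factorization are
non-isomorphisms (their `RB`-components `r`, `s ≫ φ_D` are not invertible).
[cite: MochizukiFrdI2008, §0 p.18] -/
theorem not_isIrreducibleHom_of_over_pt {Y : C πR} (φ : U pt ⟶ Y) : ¬ IsIrreducibleHom φ := by
  rintro ⟨-, hfac⟩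
  rcases hfac (uHom r) (lift₂ φ (s ≫ φ.snd)) (fac_of_over_pt φ) with hα | hβ
  · haveI := hα
    exact not_isIso_s_comp φ.snd (CFP.isIso_snd (lift₂ φ (s ≫ φ.snd)))
  · haveI := hβ
    exact not_isIso_from_pt r (CFP.isIso_snd (uHom r))

/-- **`U pt` is an ANCHOR of `C`** (vacuously: no irreducible arrow leaves it), although it is isotropic.
[cite: MochizukiFrdI2008, §0 p.18] -/
theorem isAnchor_unit : IsAnchor (U pt) := by
  refine Set.Finite.subset Set.finite_empty ?_
  rintro x ⟨f, hf, -⟩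
  exact (not_isIrreducibleHom_of_over_pt f.hom hf).elim

/-- `U two` is a subanchor (`(id, s) : U two → U pt`). [cite: MochizukiFrdI2008, §0 p.18] -/
theorem isSubanchor_unit_two : IsSubanchor (U two) := ⟨U pt, isAnchor_unit, ⟨uHom s⟩⟩


/-- The swap `(id, τ)` as an automorphism of `U two`. [cite: MochizukiFrdII2008, Ex 3.3 (i) p.28] -/
def T : U two ≅ U two :=
  ⟨uHom τ, uHom τ, CFP.hom_ext (Category.id_comp _) τ_comp_τ, CFP.hom_ext (Category.id_comp _) τ_comp_τ⟩

/-- The group `G = {γ ∈ Aut(U two) | γ₀ = id}` (it contains `T`). [cite: MochizukiFrdI2008, §0 p.18] -/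
def G : Subgroup (Aut (U two)) where
  carrier := {γ | γ.hom.fst = 𝟙 _}
  mul_mem' := by
    intro γ δ hγ hδ
    change (γ * δ).hom.fst = 𝟙 _
    rw [Aut.Aut_mul_def, Iso.trans_hom, CFP.comp_fst, show γ.hom.fst = 𝟙 _ from hγ,
      show δ.hom.fst = 𝟙 _ from hδ, Category.comp_id]
  one_mem' := rfl
  inv_mem' := by
    intro γ hγ
    change γ.inv.fst = 𝟙 _
    have h : (γ.hom ≫ γ.inv).fst = 𝟙 _ := by rw [γ.hom_inv_id]; rfl
    rw [CFP.comp_fst, show γ.hom.fst = 𝟙 _ from hγ, Category.id_comp] at h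
    exact h

/-- **`(id, s) : U two → U pt` is a categorical quotient of `U two` by `G`**: a `G`-invariant arrow
`ψ` out of `U two` is `T`-invariant, so its `RB`-component is constant and `ψ` descends (uniquely) along `s`.
[cite: MochizukiFrdI2008, §0 p.18] -/
theorem isCategoricalQuotient_uHom_s : IsCategoricalQuotient G (uHom s) := by
  refine ⟨fun γ hγ => ?_, fun Y ψ hψ => ?_⟩
  · refine CFP.hom_ext ?_ (hom_pt_ext _ _)
    rw [CFP.comp_fst, show γ.hom.fst = 𝟙 _ from hγ, Category.id_comp]
  · have hT : T.hom ≫ ψ = ψ := hψ T rfl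
    have hc : ψ.snd true = ψ.snd false := apply_eq_of_τ_comp ψ.snd (congrArg CFP.Hom.snd hT)
    let g : pt ⟶ Y.snd := fun _ => ψ.snd false
    have hsg : s ≫ g = ψ.snd := by
      funext b
      rw [comp_app]
      cases b
      · rfl
      · exact hc.symm
    let ψ' : U pt ⟶ Y := ⟨ψ.fst, g, ψ.w⟩
    refine ⟨ψ', CFP.hom_ext (Category.id_comp _) hsg, fun ψ'' h => CFP.hom_ext ?_ (funext fun u => ?_)⟩
    · have h1 := congrArg CFP.Hom.fst h
      rw [CFP.comp_fst, uHom_fst, Category.id_comp] at h1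
      exact h1
    · have h2 : s ≫ ψ''.snd = ψ.snd := congrArg CFP.Hom.snd h
      exact (congrFun h2 false : _)

/-- **… and it is mono-minimal**: a monomorphism `ζ` out of `U two` with `ζ ≫ φ' = (id, s)` has injective
(hence invertible) `RB`-component — test against `id` and `T` — and split-mono (hence invertible, `C₀`
being totally epimorphic) `C₀`-component. [cite: MochizukiFrdI2008, §0 p.18] -/
theorem isMonoMinimalQuotient_uHom_s : IsMonoMinimalQuotient G (uHom s) := by
  refine ⟨isCategoricalQuotient_uHom_s, ?_⟩
  intro A' ζ φ' hζ hmono _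
  haveI := hmono
  -- the `RB`-component takes distinct values: otherwise `T ≫ ζ = ζ`, contradicting `Mono ζ`
  have hne : ζ.snd true ≠ ζ.snd false := by
    intro h
    have hc : T.hom ≫ ζ = 𝟙 _ ≫ ζ :=
      CFP.hom_ext rfl ((τ_comp_eq_of_apply_eq ζ.snd h).trans (Category.id_comp ζ.snd).symm)
    have hT : T.hom = 𝟙 _ := (cancel_mono ζ).1 hc
    have h2 : τ = 𝟙 two := congrArg CFP.Hom.snd hT
    exact Bool.false_ne_true (congrFun h2 true)
  haveI : IsIso ζ.snd := isIso_of_apply_ne ζ.snd hne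
  -- the `C₀`-component is a split monomorphism of the totally epimorphic `C₀`
  have hfst : ζ.fst ≫ φ'.fst = 𝟙 _ := by
    have h := congrArg CFP.Hom.fst hζ
    rw [CFP.comp_fst] at h
    exact h
  haveI : IsSplitMono ζ.fst := IsSplitMono.mk' ⟨φ'.fst, hfst⟩
  haveI : Epi ζ.fst := C0.isTotallyEpimorphic.epi ζ.fst
  haveI : IsIso ζ.fst := isIso_of_epi_of_isSplitMono ζ.fst
  exact CFP.isIso_of_isIso_fst_snd ζ

/-- **`U pt` is an ISO-SUBANCHOR of `C`.** [cite: MochizukiFrdI2008, §0 p.18] -/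
theorem isIsoSubanchor_unit : IsIsoSubanchor (U pt) :=
  ⟨U two, G, uHom s, isSubanchor_unit_two, isMonoMinimalQuotient_uHom_s⟩

/-- **… and `U pt` is ISOTROPIC** (its angular region is the isotropic region of tip `1`; Ex. 3.3 (ii)).
[cite: MochizukiFrdII2008, Ex 3.3 (ii) p.28] -/
theorem isIsotropic_unit : PreFrobenioid.IsIsotropic (C.toElem πR) (U pt) :=
  (Ex33ii_isotropic_iff_holds πR (U pt)).2 (AngularRegion.isIsotropic_isotropicOfTip 1)


namespace RB

/-- Every object of `RB` is complex (the functor is constant at `Spec ℂ`). [cite: MochizukiFrdII2008, Def 3.1 (v) p.24] -/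
theorem complexObjects (d : RB) : RC.complexObjects (baseRC πR) d :=
  (D0.isComplex_toArchBase_iff D0.complex).mpr rfl

/-- In the full subcategory `RB[ℂ]`, an arrow whose underlying map is an isomorphism is an isomorphism. [folklore] -/
private theorem isIso_of_isIso_hom {A B : RC.ComplexPart (baseRC πR)} (f : A ⟶ B) [IsIso f.hom] : IsIso f :=
  ⟨⟨ObjectProperty.homMk (inv f.hom), ObjectProperty.hom_ext _ (IsIso.hom_inv_id f.hom),
    ObjectProperty.hom_ext _ (IsIso.inv_hom_id f.hom)⟩⟩

/-- **`two` is an anchor of `RB[ℂ] = RB`**: a map out of `two` is either injective (an isomorphism) or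
constant, and a constant map `φ` factors as `c ≫ φ` with `c`, `φ` both non-invertible — so no arrow out of
`two` is irreducible. [cite: MochizukiFrdII2008, Def 3.1 (v) p.25] -/
theorem isAnchor_two : IsAnchor (⟨two, complexObjects two⟩ : RC.ComplexPart (baseRC πR)) := by
  refine Set.Finite.subset Set.finite_empty ?_
  rintro x ⟨f, ⟨hni, hfac⟩, -⟩
  exfalso
  by_cases h : f.hom.hom true = f.hom.hom false
  · -- constant: `f.hom = c ≫ f.hom`
    let cc : (⟨two, complexObjects two⟩ : RC.ComplexPart (baseRC πR)) ⟶ ⟨two, complexObjects two⟩ :=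
      ObjectProperty.homMk (s ≫ r)
    have hcf : cc ≫ f.hom = f.hom := by
      refine ObjectProperty.hom_ext _ ?_
      change (s ≫ r) ≫ f.hom.hom = f.hom.hom
      funext b
      rw [comp_app]
      cases b
      · rfl
      · exact h.symm
    rcases hfac cc f.hom hcf with hα | hβ
    · exact hni hα
    · haveI := hβ
      haveI : IsIso ((RC.complexObjects (baseRC πR)).ι.map cc) := inferInstance
      exact not_isIso_of_apply_eq (s ≫ r) rfl (this : IsIso (s ≫ r))
  · haveI : IsIso f.hom.hom := isIso_of_apply_ne f.hom.hom h
    exact hni (isIso_of_isIso_hom f.hom)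

/-- `two` is an RC-anchor, hence an RC-subanchor. [cite: MochizukiFrdII2008, Def 3.1 (v) p.25] -/
theorem isRCSubanchor_two : RC.IsRCSubanchor (baseRC πR) two :=
  ⟨two, ⟨complexObjects two, isAnchor_two⟩, ⟨𝟙 _⟩⟩

/-- The identity of `two` is a mono-minimal categorical quotient by the trivial group (a monomorphism out
of `two` is an isomorphism). [cite: MochizukiFrdI2008, §0 p.18] -/
theorem isMonoMinimalQuotient_id_two : IsMonoMinimalQuotient (⊥ : Subgroup (Aut two)) (𝟙 two) := by
  refine ⟨⟨fun γ hγ => ?_, fun Y ψ _ => ⟨ψ, Category.id_comp ψ, fun ψ' h => ?_⟩⟩, ?_⟩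
  · rw [Subgroup.mem_bot] at hγ
    subst hγ
    rfl
  · exact (Category.id_comp ψ').symm.trans h
  · intro A' ζ _ _ hm _
    haveI := hm
    exact isIso_of_mono ζ

/-- `s : two → pt` is a mono-minimal categorical quotient of `two` by `Aut(two)`: an `Aut(two)`-invariant
map out of `two` is swap-invariant, hence constant, hence factors uniquely through `s`.
[cite: MochizukiFrdI2008, §0 p.18] -/
theorem isMonoMinimalQuotient_s : IsMonoMinimalQuotient (⊤ : Subgroup (Aut two)) s := by
  refine ⟨⟨fun γ _ => hom_pt_ext _ _, fun Y ψ hψ => ?_⟩, ?_⟩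
  · have hc : ψ true = ψ false := apply_eq_of_τ_comp ψ (hψ τIso (Subgroup.mem_top _))
    refine ⟨fun _ => ψ false, ?_, fun ψ' h => ?_⟩
    · funext b
      rw [comp_app]
      cases b
      · rfl
      · exact hc.symm
    · funext u
      exact congrFun h false
  · intro A' ζ _ _ hm _
    haveI := hm
    exact isIso_of_mono ζ

/-- **`RB → D₀` is of RC-iso-subanchor type** (Def. 3.1 (v) (d)): `two` via the identity, `pt` via
`s : two → pt`. [cite: MochizukiFrdII2008, Def 3.1 (v) p.25] -/
theorem isOfRCIsoSubanchorType : RC.IsOfRCIsoSubanchorType (baseRC πR) := by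
  refine ⟨fun d => ?_⟩
  cases d with
  | pt => exact ⟨two, ⊤, s, isRCSubanchor_two, isMonoMinimalQuotient_s⟩
  | two => exact ⟨two, ⊥, 𝟙 two, isRCSubanchor_two, isMonoMinimalQuotient_id_two⟩

end RB


/-- **Proposition 3.5 (ii) for `C` FAILS over the retract base** (connected, of RC-iso-subanchor type, NOT
totally epimorphic): the isotropic object `U pt` is an iso-subanchor. [cite: MochizukiFrdII2008, Prop 3.5 (ii) p.34] -/
theorem not_prop35ii_C_retract :
    ¬ Literature.AlgebraicGeometry.Frobenioids.ArchFrd.Prop35ii_C πR := fun h =>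
  (h RB.isOfRCIsoSubanchorType (U pt)).2 isIsoSubanchor_unit isIsotropic_unit

/-- **Packaged: the standing hypothesis «`D` totally epimorphic» of Example 3.3 (i) cannot be dropped from
Proposition 3.5 (ii)** — there is a connected base `D → D₀` of RC-iso-subanchor type, not totally
epimorphic, for which the typed instance `Prop35ii_C` fails (whereas `ArchFrd.prop35ii_C` proves it for every
totally epimorphic base). [cite: MochizukiFrdII2008, Prop 3.5 (ii) p.34] -/
theorem exists_base_not_prop35ii_C :
    ∃ π : RB ⥤ D0, IsGraphConnected RB ∧ ¬ IsTotallyEpimorphic RB ∧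
      RC.IsOfRCIsoSubanchorType (baseRC π) ∧
        ¬ Literature.AlgebraicGeometry.Frobenioids.ArchFrd.Prop35ii_C π :=
  ⟨πR, RB.isGraphConnected, RB.not_isTotallyEpimorphic, RB.isOfRCIsoSubanchorType, not_prop35ii_C_retract⟩

end ArchFrd
end
end Literature.AlgebraicGeometry.Frobenioids
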